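import Summits.ResolutionOfSingularities.ResolutionOfSingularities.Theorems.PurelyInseparableDim4E2OfCJSStrictTransform
import Summits.ResolutionOfSingularities.ResolutionOfSingularities.Theorems.PurelyInseparableDim4E2OfCJSSettingPrime
import HarnessLib

/-!
# F4-I(p,p) from CJS — (M-c_p): the controlled transform of `(z^p + F)·𝒪` with weight `p` along a point blow-up IS the
# blow-up of the hypersurface at the point, ARBITRARY ambient with a chart, EVERY exponent `p ≥ 1` (cell `res-dim4-pi`,
# p-program of desk WORD #66)

[OURS · counted 0 · AI work weaker than expert review.]  Cell `res-dim4-pi` (D-0157 DOOR 2), seat `res-dim4-p-11` g2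
(row (M-c_p) hand; holder res-dim4-p-2 g2).  NOTHING here proves `NoWideTrap p p`, the Cossart–Jannsen–Saito theorem, or
resolution of singularities in dimension ≥ 4 / characteristic `p`.

The p = 3 file `…E2OfCJSStrictTransform` (p668759, `E2OfCJS.strictTransformBlowup`) used `3` only as the weight / mult /
order numeral and through res-dim4-p-2 g2's `hyp_three_ne_zero`.  This file is its generalisation `3 ↦ p` (any `p ≠ 0`,
any field, no characteristic), in δ-UNFOLDED form — the adapter to the p-typed Prop (`StrictTransformBlowupP p`, typed
by the (M-b_p) hand / the holder) is one line once it exists: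

* `isEffectiveCartier_hypSheaf` (principal, non-zero by res-dim4-p-2 g2's `Prime.hyp_ne_zero`, on the domain `K[z,x]`);
* `colon_controlledTransform_hypSheaf_le` — colon-stability of `τᶜ((z^p+F)·𝒪, p)` on the blow-up of `𝔸⁵` at the origin
  (Kollár 3.30.2 `IsBlowup.strictTransformIdeal_eq_controlledTransform`: `𝔸⁵` regular, `ord₀ = p`
  (`idealOrder_hypSheaf_ξ`, characteristic-free), Cartier);
* `colon_controlledTransform_le` — descent to an arbitrary ambient `Z` with a chart (flat base change along the chart,
  `…StrictTransform.colon_comap_vanishingIdeal_le_of_comap`);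
* **`strictTransformBlowupP (hp : p ≠ 0)`** / **`strictTransformBlowupP_prime (p) [Fact p.Prime]`** — res-dim4-p-7 g2's
  `StrictTransformBlowup` (p667552) with `3 ↦ p` VERBATIM as a THEOREM (no new `Prop` here; it is literally the hypothesis
  `hMc` of p-7's `Prime.localizationRow_of_strictTransform p`), over the δ-unfolded content
  **`strictTransformBlowupP_unfolded`** — for `Z` locally Noetherian, `M : MarkedIdeal Z` with `M.mult = p`, an open
  immersion `φ : 𝔸⁵_K ⟶ Z` with `φ ξ = x`, `M.ideal.comap φ = hypSheaf p F`, `ordZero F = p`, and a blow-up `π` of the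
  closed point `x`: `V((M.transform π 𝓘_x).ideal) ⟶ V(M.ideal)` over `π` exists and is the blow-up of `V(M.ideal)` at the
  closed point `y` over `x` (p-5 g2's universal-property lemma with the two stalk-local inputs of the p = 3 file).

bears_on: LADDER-RESOLUTION:D157-DOOR2 (res-dim4-pi · p-program · row (M-c_p)).  Supports stmt-ResolutionOfSingularities-16155
(helper).

## References

* J. Kollár, *Lectures on Resolution of Singularities* (2007), 3.30.2. [Kollar2007]
* E. Bierstone, D. Grigoriev, P. Milman, J. Włodarczyk (2011), §4 Remark (3). [BierstoneGrigorievMilmanWlodarczyk2011]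
* U. Görtz, T. Wedhorn, *Algebraic Geometry I* (2020), Def. 13.90, Prop. 13.91. [GortzWedhorn2020]
-/

set_option linter.dupNamespace false -- mandated namespace of this single-conjunct summit

noncomputable section

open CategoryTheory CategoryTheory.Limits AlgebraicGeometry TopologicalSpace IsLocalRing
open Literature.AlgebraicGeometry.Resolution
open Literature.AlgebraicGeometry.Resolution.Hauser2010 (ordZero)
open Literature.AlgebraicGeometry.Resolution.AffinePointBlowup (A P ξ isClosed_ξ)
open Literature.AlgebraicGeometry.Hironaka2017.SpecOrders (Zs St toΓ shf shf_ideal_top)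
open Scheme.IdealSheafData (vanishingIdeal)

universe u

namespace Summit.ResolutionOfSingularities.ResolutionOfSingularities.Theorems.PIDim4

namespace E2OfCJS

namespace StrictTransformP

variable {K : Type} [Field K] {p : ℕ}

/-! ## §1 `(z^p + F)·𝒪_{𝔸⁵}` is an effective Cartier divisor, every `p ≠ 0` -/

/-- **`(z^p + F)·𝒪_{𝔸⁵}` is an effective Cartier divisor** (`p ≠ 0`). [cite: GortzWedhorn2020, Def. 11.38 / (13.19)] -/
theorem isEffectiveCartier_hypSheaf (hp : p ≠ 0) (F : MvPolynomial (Fin 4) K) : IsEffectiveCartier (hypSheaf p F) := by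
  rw [Equimultiple.hypSheaf_eq_shf]
  refine isEffectiveCartier_of_ideal_top_eq_span _ (g := toΓ (A 4 K) (hyp p F))
    (StrictTransform.mem_nonZeroDivisors_toΓ (mem_nonZeroDivisors_of_ne_zero (Prime.hyp_ne_zero K p hp F))) ?_
  rw [shf_ideal_top, Ideal.map_span, Set.image_singleton]

/-! ## §2 Colon-stability of the weight-`p` controlled transform -/

/-- **Colon-stability upstairs**, weight `p = ord₀`: on the blow-up `π₀ : Y' ⟶ 𝔸⁵_K` of the origin, `τᶜ((z^p+F)·𝒪, p)` is
`𝓘_E`-colon-stable (Kollár 3.30.2). [cite: Kollar2007, 3.30.2] -/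
theorem colon_controlledTransform_hypSheaf_le (hp : p ≠ 0) {Y' : Scheme.{0}} [IsLocallyNoetherian Y'] {π₀ : Y' ⟶ P 4 K}
    (F : MvPolynomial (Fin 4) K) (hF : ordZero F = (p : ℕ∞))
    (hπ₀ : IsBlowup π₀ (vanishingIdeal (⟨{ξ 4 K}, isClosed_ξ 4 K⟩ : Closeds (P 4 K)))) :
    colon (controlledTransform π₀ (vanishingIdeal (⟨{ξ 4 K}, isClosed_ξ 4 K⟩ : Closeds (P 4 K))) (hypSheaf p F) p)
        ((vanishingIdeal (⟨{ξ 4 K}, isClosed_ξ 4 K⟩ : Closeds (P 4 K))).comap π₀) ≤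
      controlledTransform π₀ (vanishingIdeal (⟨{ξ 4 K}, isClosed_ξ 4 K⟩ : Closeds (P 4 K))) (hypSheaf p F) p := by
  have hsupp : ((vanishingIdeal (⟨{ξ 4 K}, isClosed_ξ 4 K⟩ : Closeds (P 4 K))).support : Set (P 4 K)) = {ξ 4 K} :=
    Scheme.IdealSheafData.coe_support_vanishingIdeal _
  have hη : IsGenericPoint (ξ 4 K)
      ((vanishingIdeal (⟨{ξ 4 K}, isClosed_ξ 4 K⟩ : Closeds (P 4 K))).support : Set (P 4 K)) := by
    rw [hsupp, isGenericPoint_def, (isClosed_ξ 4 K).closure_eq]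
  have hint : interior ((vanishingIdeal (⟨{ξ 4 K}, isClosed_ξ 4 K⟩ : Closeds (P 4 K))).support : Set (P 4 K)) = ∅ := by
    rw [hsupp]
    exact StrictTransformBlowup.interior_singleton_eq_empty_of_not_isOpen StrictTransform.not_isOpen_singleton_ξ
  have hstrict := IsBlowup.strictTransformIdeal_eq_controlledTransform StrictTransform.isRegular_P
    (isRegular_subscheme_vanishingIdeal_singleton (isClosed_ξ 4 K)) hη hint
    (StrictTransform.idealOrder_hypSheaf_ξ hp F hF) (isEffectiveCartier_hypSheaf hp F) hπ₀
  exact StrictTransformBlowup.colon_controlledTransform_le_of_strictTransformIdeal_eq _ _ _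
    (by exact_mod_cast hstrict)

/-- **Colon-stability on `Z'`**, weight `p` (flat base change along the chart + descent along the open immersion
`Z' ×_Z 𝔸⁵ ⟶ Z'`). [cite: GortzWedhorn2020, Prop. 13.91] -/
theorem colon_controlledTransform_le (hp : p ≠ 0) {Z Z' : Scheme.{0}} [IsLocallyNoetherian Z] (F : MvPolynomial (Fin 4) K)
    (hF : ordZero F = (p : ℕ∞)) (M : MarkedIdeal Z) {x : Z} (hx : IsClosed ({x} : Set Z)) (φ : P 4 K ⟶ Z)
    [IsOpenImmersion φ] (π : Z' ⟶ Z) (hφ : φ (ξ 4 K) = x) (hM : M.ideal.comap φ = hypSheaf p F)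
    (hπ : IsBlowup π (vanishingIdeal (⟨{x}, hx⟩ : Closeds Z))) :
    colon (controlledTransform π (vanishingIdeal (⟨{x}, hx⟩ : Closeds Z)) M.ideal p)
        ((vanishingIdeal (⟨{x}, hx⟩ : Closeds Z)).comap π) ≤
      controlledTransform π (vanishingIdeal (⟨{x}, hx⟩ : Closeds Z)) M.ideal p := by
  haveI : IsLocallyNoetherian Z' := hπ.isLocallyNoetherian
  haveI : IsLocallyNoetherian (pullback π φ) := isLocallyNoetherian_of_isOpenImmersion (pullback.fst π φ)
  have hC : (vanishingIdeal (⟨{x}, hx⟩ : Closeds Z)).comap φ =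
      vanishingIdeal (⟨{ξ 4 K}, isClosed_ξ 4 K⟩ : Closeds (P 4 K)) :=
    Equimultiple.comap_vanishingIdeal_singleton_of_isOpenImmersion φ (ξ 4 K) hx hφ (isClosed_ξ 4 K)
  have hπ₀ : IsBlowup (pullback.snd π φ) (vanishingIdeal (⟨{ξ 4 K}, isClosed_ξ 4 K⟩ : Closeds (P 4 K))) := by
    rw [← hC]; exact hπ.pullback_snd_of_flat φ
  have hup := colon_controlledTransform_hypSheaf_le hp F hF hπ₀
  have hsq : pullback.fst π φ ≫ π = pullback.snd π φ ≫ φ := pullback.condition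
  have hT : (controlledTransform π (vanishingIdeal (⟨{x}, hx⟩ : Closeds Z)) M.ideal p).comap (pullback.fst π φ) =
      controlledTransform (pullback.snd π φ) (vanishingIdeal (⟨{ξ 4 K}, isClosed_ξ 4 K⟩ : Closeds (P 4 K)))
        (hypSheaf p F) p := by
    rw [comap_controlledTransform_of_flat (t := φ) hsq, hC, hM]
  have hE : (((vanishingIdeal (⟨{x}, hx⟩ : Closeds Z)).comap π).comap (pullback.fst π φ)) =
      (vanishingIdeal (⟨{ξ 4 K}, isClosed_ξ 4 K⟩ : Closeds (P 4 K))).comap (pullback.snd π φ) := by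
    rw [← Scheme.IdealSheafData.comap_comp, hsq, Scheme.IdealSheafData.comap_comp, hC]
  refine StrictTransform.colon_comap_vanishingIdeal_le_of_comap π hx _ (pullback.fst π φ) ?_ ?_
  · intro z' hz'
    rw [Scheme.Pullback.range_fst]
    exact ⟨ξ 4 K, hφ.trans hz'.symm⟩
  · rw [hT, hE]
    exact hup

/-! ## §3 (M-c_p), δ-unfolded -/

/-- **(M-c_p) δ-UNFOLDED, every `p ≠ 0`, every field**: for a locally Noetherian `Z` with a chart `φ : 𝔸⁵_K ⟶ Z` at the
closed point `x` on which the marked ideal `M` of multiplicity `p` reads `(z^p + F)·𝒪`, `ordZero F = p`, and a blow-up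
`π : Z' ⟶ Z` of `x`: the subscheme of `M.transform π 𝓘_x` maps to `V(M.ideal)` over `π`, and this map is the blow-up of
`V(M.ideal)` at the (closed) point `y` over `x`. [OURS · (M-c_p)] [cite: Kollar2007, 3.30.2]
[cite: BierstoneGrigorievMilmanWlodarczyk2011, §4 Remark (3)] -/
theorem strictTransformBlowupP_unfolded (hp : p ≠ 0) {Z Z' : Scheme.{0}} [IsLocallyNoetherian Z]
    (F : MvPolynomial (Fin 4) K) (M : MarkedIdeal Z) (x : Z) (hx : IsClosed ({x} : Set Z)) (φ : P 4 K ⟶ Z)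
    [IsOpenImmersion φ] (π : Z' ⟶ Z) (hmult : M.mult = p) (hF : ordZero F = (p : ℕ∞)) (hφ : φ (ξ 4 K) = x)
    (hM : M.ideal.comap φ = hypSheaf p F) (hπ : IsBlowup π (vanishingIdeal (⟨{x}, hx⟩ : Closeds Z))) :
    ∃ ρ : (M.transform π (vanishingIdeal (⟨{x}, hx⟩ : Closeds Z))).ideal.subscheme ⟶ M.ideal.subscheme,
      ρ ≫ M.ideal.subschemeι = (M.transform π (vanishingIdeal (⟨{x}, hx⟩ : Closeds Z))).ideal.subschemeι ≫ π ∧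
      ∀ (y : M.ideal.subscheme) (hy : IsClosed ({y} : Set M.ideal.subscheme)), M.ideal.subschemeι y = x →
        IsBlowup ρ (vanishingIdeal ⟨{y}, hy⟩) := by
  haveI : IsLocallyNoetherian Z' := hπ.isLocallyNoetherian
  have hM' : (M.transform π (vanishingIdeal (⟨{x}, hx⟩ : Closeds Z))).ideal =
      controlledTransform π (vanishingIdeal (⟨{x}, hx⟩ : Closeds Z)) M.ideal p := by
    rw [MarkedIdeal.transform_ideal, hmult]
  have hord : idealOrder M.ideal x = (p : ℕ∞) := by
    rw [← hφ, ← idealOrder_comap_of_isOpenImmersion φ M.ideal (ξ 4 K), hM]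
    exact StrictTransform.idealOrder_hypSheaf_ξ hp F hF
  have hle : M.ideal ≤ vanishingIdeal (⟨{x}, hx⟩ : Closeds Z) ^ p :=
    StrictTransform.le_vanishingIdeal_singleton_pow_of_le_idealOrder M.ideal hx (by rw [hord])
  have hcart := StrictTransformBlowup.isEffectiveCartier_comap_subschemeι_of_colon_le hπ.isEffectiveCartier
    (colon_controlledTransform_le hp F hF M hx φ π hφ hM hπ)
  rw [hM']
  obtain ⟨ρ, hρ⟩ := StrictTransformBlowup.exists_hom_subscheme_controlledTransform_weight π
    (vanishingIdeal (⟨{x}, hx⟩ : Closeds Z)) M.ideal p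
  refine ⟨ρ, hρ, fun y hy hyx => ?_⟩
  rw [← StrictTransform.comap_subschemeι_vanishingIdeal_singleton_eq M.ideal hx y hyx hy]
  exact StrictTransformBlowup.isBlowup_subscheme_controlledTransform_of_isEffectiveCartier hπ hle hcart ρ hρ

end StrictTransformP

/-- **ROW (M-c_p) IN THE SHAPE THE (M-b_p) HAND CONSUMES** — res-dim4-p-7 g2's `StrictTransformBlowup` (p667552) with
`3 ↦ p` VERBATIM, stated as a theorem (no new `Prop`: the holder types `StrictTransformBlowupP p` if wanted, and this
term inhabits it by `exact`); it is literally the hypothesis `hMc` of p-7's `Prime.localizationRow_of_strictTransform p`.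
Every `p ≠ 0`, every field. [OURS · (M-c_p) · counted 0] [cite: Kollar2007, 3.30.2]
[cite: BierstoneGrigorievMilmanWlodarczyk2011, §4 Remark (3)] -/
theorem strictTransformBlowupP {p : ℕ} (hp : p ≠ 0) :
    ∀ (K : Type) [Field K] (F : MvPolynomial (Fin 4) K) (Z Z' : Scheme.{0}) [IsLocallyNoetherian Z]
      [IsLocallyNoetherian Z'] (M : MarkedIdeal Z) (M' : MarkedIdeal Z') (x : Z) (hx : IsClosed ({x} : Set Z))
      (φ : P 4 K ⟶ Z) [IsOpenImmersion φ] (π : Z' ⟶ Z),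
      M.mult = p → ordZero F = (p : ℕ∞) → φ (ξ 4 K) = x → M.ideal.comap φ = hypSheaf p F →
      IsBlowup π (vanishingIdeal ⟨{x}, hx⟩) → M' = M.transform π (vanishingIdeal ⟨{x}, hx⟩) →
      ∃ ρ : M'.ideal.subscheme ⟶ M.ideal.subscheme,
        ρ ≫ M.ideal.subschemeι = M'.ideal.subschemeι ≫ π ∧
        ∀ (y : M.ideal.subscheme) (hy : IsClosed ({y} : Set M.ideal.subscheme)), M.ideal.subschemeι y = x →
          IsBlowup ρ (vanishingIdeal ⟨{y}, hy⟩) := by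
  intro K _ F Z Z' _ _ M M' x hx φ _ π hmult hF hφ hM hπ hMM'
  subst hMM'
  exact StrictTransformP.strictTransformBlowupP_unfolded hp F M x hx φ π hmult hF hφ hM hπ

/-- The same at every PRIME `p` (the p-program's binder convention). [OURS · (M-c_p)] [cite: Kollar2007, 3.30.2] -/
theorem strictTransformBlowupP_prime (p : ℕ) [hp : Fact p.Prime] :
    ∀ (K : Type) [Field K] (F : MvPolynomial (Fin 4) K) (Z Z' : Scheme.{0}) [IsLocallyNoetherian Z]
      [IsLocallyNoetherian Z'] (M : MarkedIdeal Z) (M' : MarkedIdeal Z') (x : Z) (hx : IsClosed ({x} : Set Z))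
      (φ : P 4 K ⟶ Z) [IsOpenImmersion φ] (π : Z' ⟶ Z),
      M.mult = p → ordZero F = (p : ℕ∞) → φ (ξ 4 K) = x → M.ideal.comap φ = hypSheaf p F →
      IsBlowup π (vanishingIdeal ⟨{x}, hx⟩) → M' = M.transform π (vanishingIdeal ⟨{x}, hx⟩) →
      ∃ ρ : M'.ideal.subscheme ⟶ M.ideal.subscheme,
        ρ ≫ M.ideal.subschemeι = M'.ideal.subschemeι ≫ π ∧
        ∀ (y : M.ideal.subscheme) (hy : IsClosed ({y} : Set M.ideal.subscheme)), M.ideal.subschemeι y = x →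
          IsBlowup ρ (vanishingIdeal ⟨{y}, hy⟩) :=
  strictTransformBlowupP hp.out.ne_zero

end E2OfCJS

end Summit.ResolutionOfSingularities.ResolutionOfSingularities.Theorems.PIDim4

end
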